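import Summits.Ventures.DiscreteObjects.Hadamard.NonCyclicLP333
import Summits.Ventures.DiscreteObjects.Hadamard.PAFParityTools

/-!
# No conference matrix of order 334 with a core developed over the NON-CYCLIC abelian group of order 333 (kernel)

Framing: lottery ticket; floor = certified bounds/negative ranges.  Cell pub-namedobj (venture DiscreteObjects),
target (H), hadamard gen 27; companion of `ConferencePairSymmetric` §3 (`no_cyclicCore_conference334`: no CIRCULANT core).
The groups of order `333 = 3²·37` that are abelian are `ℤ/333` and `G333 = (ℤ/3 × ℤ/3) × ℤ/37` (the tree's `G333`, gen 3).  A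
conference matrix of order `334` whose core is group-developed ('type 1') over an abelian group `G` of order `333` is, in first-row
terms, an array `a : G → {0, ±1}` with `a 0 = 0`, `a g = ±1 (g ≠ 0)` and `PAF_a(g) = −1` for all `g ≠ 0` — equivalently a
Paley-type partial difference set / conference graph that is a Cayley graph on `G`.  THIS FILE excludes `G = G333`:
* general finite abelian group tools: **`pafOn_mod_four`** (`PAF ≡ |G| (mod 4)` for `±1` arrays — the product argument of gen 19's
  `paf_mod_four`), `pafOn_fill_zero`, **`coreOn_symm_of_paf_neg_one`** (`|G| ≡ 1 (mod 4)`: a cored array with `PAF = −1` is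
  symmetric, `a(−g) = a(g)`);
* the `ℤ/37`-fold `E(v) = Σ_j a(v, j)` (`comp37`, gen 3): `comp37_shift_sum` (`Σ_v E(v)E(v+w) = Σ_t PAF_a(w,t)`), symmetry and
  parities of `E`, the class sums `296 / −37`, the row sum `0`;
* **`z3sqFold_core334_system_empty`** (`decide +kernel`, `12⁴` cases): with `F₁..F₄` the values of `E` on the four `±`-pairs of
  `ℤ/3 × ℤ/3` and `E(0) = −2ΣFᵢ`, the equations `E(0)² + 2ΣFᵢ² = 296` and (shift `(1,0)`)
  `2E(0)F₁ + F₁² + 2F₂F₃ + 2F₃F₄ + 2F₂F₄ = −37` have no solution in odd `|Fᵢ| ≤ 11` (an independent plain-Python enumeration agrees: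
  132 tuples pass the square sum, none the shift equation);
* **`no_G333Core_conference334`** — no conference matrix of order `334` has a core developed over `G333`; with
  `no_cyclicCore_conference334`: **no `C(334)` has a core developed over ANY abelian group of order `333`** (no abelian Paley-type
  partial difference set of order `333`).  In print this sits inside the theory of abelian partial difference sets (Ma); here it is an
  elementary kernel certificate.  `C(334)` itself and `H(668)` untouched.  Ours; no `sorry`.
-/

namespace Summit.Ventures.DiscreteObjects.Hadamard

open Finset BigOperators

open Literature.Combinatorics.Designs.LegendrePairs (PAFOn IsPMOn sq_rowsum_on)

/-! ## §1 Parity tools over a finite abelian group -/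

section general
variable {G : Type*} [AddCommGroup G] [Fintype G] [DecidableEq G]

omit [DecidableEq G] in
/-- **`PAF ≡ |G| (mod 4)`** for a `±1` array on a finite abelian group (the number of `i` with `c(i)c(i+s) = −1` is even because
`∏_i c(i)c(i+s) = (∏ c)² = 1`). -/
theorem pafOn_mod_four (c : G → ℤ) (hc : IsPMOn c) (s : G) : ∃ k : ℤ, PAFOn c s = Fintype.card G - 4 * k := by
  set N := (univ.filter fun i : G => c i * c (i + s) = -1).card with hN
  have hterm : ∀ i : G, c i * c (i + s) = if c i * c (i + s) = -1 then -1 else 1 := by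
    intro i
    split_ifs with h
    · exact h
    · rcases hc i with h1 | h1 <;> rcases hc (i + s) with h2 | h2 <;> simp_all
  have hsum : PAFOn c s = Fintype.card G - 2 * N := by
    unfold PAFOn
    rw [Finset.sum_congr rfl fun i _ => hterm i, Finset.sum_ite, Finset.sum_const, Finset.sum_const, smul_neg,
      nsmul_eq_mul, nsmul_eq_mul, mul_one, ← hN]
    have hsplit := Finset.card_filter_add_card_filter_not (s := (univ : Finset G)) (fun i => c i * c (i + s) = -1)
    rw [Finset.card_univ, ← hN] at hsplit
    have h2 : ((univ.filter fun i : G => ¬ c i * c (i + s) = -1).card : ℤ) = Fintype.card G - N := by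
      have : (N : ℤ) + (univ.filter fun i : G => ¬ c i * c (i + s) = -1).card = Fintype.card G := by
        exact_mod_cast hsplit
      linarith
    rw [h2]; ring
  have hprod : ∏ i : G, (c i * c (i + s)) = 1 := by
    rw [Finset.prod_mul_distrib, Fintype.prod_equiv (Equiv.addRight s) (fun i => c (i + s)) c (fun i => rfl), ← sq]
    rcases prod_pm univ c (fun i _ => hc i) with h | h <;> rw [h] <;> norm_num
  have hprod' : ∏ i : G, (c i * c (i + s)) = (-1) ^ N := by
    rw [Finset.prod_congr rfl fun i _ => hterm i, Finset.prod_ite, Finset.prod_const, Finset.prod_const, one_pow,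
      mul_one, ← hN]
  rw [hprod'] at hprod
  have hev : Even N := (neg_one_pow_eq_one_iff_even (by norm_num)).mp hprod
  obtain ⟨k, hk⟩ := hev
  exact ⟨k, by rw [hsum, hk]; push_cast; ring⟩

/-- **filling the zero** over a group: `PAF_c(s) = PAF_a(s) + a(s) + a(−s)` for `s ≠ 0`, `c = a` except `c 0 = 1`. -/
theorem pafOn_fill_zero (a : G → ℤ) (ha0 : a 0 = 0) {s : G} (hs : s ≠ 0) :
    PAFOn (fun i => if i = 0 then 1 else a i) s = PAFOn a s + a s + a (-s) := by
  unfold PAFOn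
  have hms : (-s : G) ≠ 0 := fun h => hs (neg_eq_zero.mp h)
  have hterm : ∀ i : G, (if i = 0 then (1 : ℤ) else a i) * (if i + s = 0 then 1 else a (i + s)) =
      a i * a (i + s) + ((if i = 0 then a s else 0) + (if i = -s then a (-s) else 0)) := by
    intro i
    by_cases hi : i = 0
    · subst hi
      have h1 : (0 : G) + s ≠ 0 := by rwa [zero_add]
      have h0s : (0 : G) ≠ -s := fun h => hms h.symm
      rw [if_pos rfl, if_neg h1, if_pos rfl, if_neg h0s, zero_add, ha0]; ring
    · by_cases his : i = -s
      · subst his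
        rw [if_neg hms, if_pos (neg_add_cancel s), if_neg hms, if_pos rfl, neg_add_cancel, ha0]; ring
      · have h2 : i + s ≠ 0 := fun h => his (eq_neg_of_add_eq_zero_left h)
        rw [if_neg hi, if_neg h2, if_neg hi, if_neg his]; ring
  rw [Finset.sum_congr rfl (fun i _ => hterm i), Finset.sum_add_distrib, Finset.sum_add_distrib,
    Finset.sum_ite_eq' Finset.univ (0 : G), Finset.sum_ite_eq' Finset.univ (-s : G)]
  simp only [Finset.mem_univ, if_true]; ring

/-- **a cored array with `PAF = −1` on a group of order `≡ 1 (mod 4)` is symmetric.** -/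
theorem coreOn_symm_of_paf_neg_one (hG : Fintype.card G % 4 = 1) (a : G → ℤ) (ha0 : a 0 = 0)
    (ha : ∀ i, i ≠ 0 → a i = 1 ∨ a i = -1) (hpaf : ∀ s : G, s ≠ 0 → PAFOn a s = -1) : ∀ x, a (-x) = a x := by
  intro x
  by_cases hx : x = 0
  · rw [hx, neg_zero]
  have hc : IsPMOn (fun i => if i = 0 then (1 : ℤ) else a i) := by
    intro i
    by_cases hi : i = 0
    · simp [hi]
    · simp only [if_neg hi]; exact ha i hi
  obtain ⟨k, hk⟩ := pafOn_mod_four _ hc x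
  rw [pafOn_fill_zero a ha0 hx, hpaf x hx] at hk
  have hxm : (-x : G) ≠ 0 := fun h => hx (neg_eq_zero.mp h)
  obtain ⟨m, hm⟩ : ∃ m : ℕ, Fintype.card G = 4 * m + 1 := ⟨Fintype.card G / 4, by omega⟩
  rw [hm] at hk
  push_cast at hk
  rcases ha x hx with h1 | h1 <;> rcases ha (-x) hxm with h2 | h2 <;> rw [h1, h2] at hk ⊢ <;> first | rfl | (exfalso; omega)

end general

/-! ## §2 The `ℤ/37`-fold of a symmetric cored array on `G333` -/

/-- **the fold identity with a shift**: `Σ_v E(v) E(v + w) = Σ_t PAF_a(w, t)` for `E = comp37 a`. -/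
theorem comp37_shift_sum (c : G333 → ℤ) (w : ZMod 3 × ZMod 3) :
    ∑ v, comp37 c v * comp37 c (v + w) = ∑ t : ZMod 37, PAFOn c (w, t) := by
  have hv : ∀ v : ZMod 3 × ZMod 3, comp37 c v * comp37 c (v + w) =
      ∑ t : ZMod 37, ∑ j : ZMod 37, c (v, j) * c (v + w, j + t) := by
    intro v
    unfold comp37
    have h1 : ∀ j : ZMod 37, ∑ t, c (v, j) * c (v + w, j + t) = ∑ j', c (v, j) * c (v + w, j') := fun j => by
      have := Equiv.sum_comp (Equiv.addLeft j) (fun j' => c (v, j) * c (v + w, j'))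
      simpa only [Equiv.coe_addLeft] using this
    calc (∑ j, c (v, j)) * (∑ j', c (v + w, j')) = ∑ j, ∑ j', c (v, j) * c (v + w, j') := Finset.sum_mul_sum _ _ _ _
      _ = ∑ j, ∑ t, c (v, j) * c (v + w, j + t) := Finset.sum_congr rfl fun j _ => (h1 j).symm
      _ = ∑ t, ∑ j, c (v, j) * c (v + w, j + t) := Finset.sum_comm
  simp_rw [hv]
  rw [Finset.sum_comm]
  refine Finset.sum_congr rfl fun t _ => ?_
  unfold PAFOn
  rw [Fintype.sum_prod_type (f := fun h : G333 => c h * c (h + (w, t)))]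
  refine Finset.sum_congr rfl fun v _ => Finset.sum_congr rfl fun j _ => ?_
  simp only [Prod.mk_add_mk]

/-- the fold of a symmetric array is symmetric. -/
lemma comp37_symm (a : G333 → ℤ) (hsym : ∀ g, a (-g) = a g) (v : ZMod 3 × ZMod 3) : comp37 a (-v) = comp37 a v := by
  unfold comp37
  rw [← Equiv.sum_comp (Equiv.neg (ZMod 37)) (fun j => a (-v, j))]
  refine Finset.sum_congr rfl (fun j _ => ?_)
  simp only [Equiv.neg_apply]
  have e : ((-v, -j) : G333) = -(v, j) := rfl
  rw [e, hsym]

/-- parities of the fold of a cored array: `comp37 a v + [v = 0] = 37 − 2k`. -/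
lemma comp37_core_parity (a : G333 → ℤ) (ha0 : a 0 = 0) (ha : ∀ g, g ≠ 0 → a g = 1 ∨ a g = -1)
    (v : ZMod 3 × ZMod 3) : ∃ k : ℤ, comp37 a v + (if v = 0 then 1 else 0) = 37 - 2 * k := by
  set b : G333 → ℤ := fun g => if a g = -1 then 1 else 0 with hb
  have hab : ∀ g : G333, a g = 1 - 2 * b g - (if g = 0 then 1 else 0) := by
    intro g
    by_cases hg : g = 0
    · subst hg; simp [hb, ha0]
    · rcases ha g hg with h | h <;> simp [hb, h, hg]
  refine ⟨∑ j : ZMod 37, b (v, j), ?_⟩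
  unfold comp37
  rw [Finset.sum_congr rfl (fun j _ => by rw [hab (v, j)]), Finset.sum_sub_distrib, Finset.sum_sub_distrib, Finset.sum_const,
    Finset.card_univ, ZMod.card, ← Finset.mul_sum]
  have h0 : ∀ j : ZMod 37, ((v, j) : G333) = 0 ↔ v = 0 ∧ j = 0 := fun j => Prod.mk_eq_zero
  simp_rw [h0]
  by_cases hv : v = 0
  · subst hv
    simp only [true_and, if_true, Finset.sum_ite_eq' Finset.univ (0 : ZMod 37), Finset.mem_univ]
    ring
  · simp only [hv, false_and, if_false, Finset.sum_const_zero]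
    ring

/-- class sums of the autocorrelation of a cored `PAF = −1` array on `G333`: `296` at `w = 0`, `−37` at `w ≠ 0`. -/
lemma core334_fold_paf (a : G333 → ℤ) (ha0 : a 0 = 0) (ha : ∀ g, g ≠ 0 → a g = 1 ∨ a g = -1)
    (hpaf : ∀ g : G333, g ≠ 0 → PAFOn a g = -1) (w : ZMod 3 × ZMod 3) :
    ∑ t : ZMod 37, PAFOn a (w, t) = if w = 0 then 296 else -37 := by
  have hP0 : PAFOn a 0 = 332 := by
    unfold PAFOn
    have e : ∀ g : G333, a g * a (g + 0) = 1 - (if g = 0 then 1 else 0) := by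
      intro g; rw [add_zero]
      by_cases hg : g = 0
      · subst hg; rw [ha0, if_pos rfl]; norm_num
      · rcases ha g hg with h | h <;> rw [h, if_neg hg] <;> norm_num
    rw [Finset.sum_congr rfl (fun g _ => e g), Finset.sum_sub_distrib, Finset.sum_const, Finset.card_univ, card_G333,
      Finset.sum_ite_eq' Finset.univ (0 : G333), if_pos (Finset.mem_univ _)]
    norm_num
  by_cases hw : w = 0
  · subst hw
    rw [if_pos rfl]
    have key : ∀ t : ZMod 37, PAFOn a ((0 : ZMod 3 × ZMod 3), t) = if t = 0 then 332 else -1 := by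
      intro t
      by_cases ht : t = 0
      · subst ht; rw [if_pos rfl]; exact hP0
      · rw [if_neg ht]; exact hpaf _ (fun h => ht (Prod.mk.inj h).2)
    rw [Finset.sum_congr rfl (fun t _ => key t)]
    decide
  · rw [if_neg hw]
    have key : ∀ t : ZMod 37, PAFOn a (w, t) = -1 := fun t => hpaf _ (fun h => hw (Prod.mk.inj h).1)
    rw [Finset.sum_congr rfl (fun t _ => key t), Finset.sum_const, Finset.card_univ, ZMod.card]
    norm_num

/-- the row sum of a cored `PAF = −1` array on `G333` vanishes. -/
lemma core334_rowsum_G333 (a : G333 → ℤ) (ha0 : a 0 = 0) (ha : ∀ g, g ≠ 0 → a g = 1 ∨ a g = -1)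
    (hpaf : ∀ g : G333, g ≠ 0 → PAFOn a g = -1) : ∑ g, a g = 0 := by
  have hsq := sq_rowsum_on a
  have e : ∑ s, PAFOn a s = ∑ s, ((if s = (0 : G333) then 333 else 0) + (-1 : ℤ)) := by
    refine Finset.sum_congr rfl (fun s _ => ?_)
    by_cases hs : s = 0
    · subst hs
      have h0 := core334_fold_paf a ha0 ha hpaf 0
      rw [if_pos rfl] at h0
      have hP0 : PAFOn a ((0 : ZMod 3 × ZMod 3), (0 : ZMod 37)) = 332 := by
        have key : ∀ t : ZMod 37, t ≠ 0 → PAFOn a ((0 : ZMod 3 × ZMod 3), t) = -1 :=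
          fun t ht => hpaf _ (fun h => ht (Prod.mk.inj h).2)
        rw [← Finset.add_sum_erase _ _ (Finset.mem_univ (0 : ZMod 37))] at h0
        rw [Finset.sum_congr rfl (fun t ht => key t (Finset.mem_erase.mp ht).1), Finset.sum_const,
          Finset.card_erase_of_mem (Finset.mem_univ _), Finset.card_univ, ZMod.card] at h0
        norm_num at h0; linarith
      have e0 : (0 : G333) = ((0 : ZMod 3 × ZMod 3), (0 : ZMod 37)) := rfl
      rw [e0, hP0, if_pos rfl]; norm_num
    · rw [hpaf s hs, if_neg hs]; norm_num
  rw [e, Finset.sum_add_distrib, Finset.sum_ite_eq' Finset.univ (0 : G333), if_pos (Finset.mem_univ _), Finset.sum_const,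
    Finset.card_univ, card_G333] at hsq
  norm_num at hsq
  exact hsq

/-- sums over `ℤ/3 × ℤ/3`, listed. -/
lemma sum_zmod3sq (f : ZMod 3 × ZMod 3 → ℤ) :
    ∑ v, f v = f (0,0) + f (1,0) + f (2,0) + f (0,1) + f (1,1) + f (2,1) + f (0,2) + f (1,2) + f (2,2) := by
  have hu : (Finset.univ : Finset (ZMod 3 × ZMod 3)) = {(0,0), (1,0), (2,0), (0,1), (1,1), (2,1), (0,2), (1,2), (2,2)} := by
    decide
  rw [hu]
  repeat rw [Finset.sum_insert (by decide)]
  rw [Finset.sum_singleton]; ring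

/-- `F² ≤ 148 ⇒ |F| ≤ 12` (private copy of the lemma of `ConferencePairSymmetric`, keeping this file a leaf). -/
private lemma abs_le_twelve_of_mul_self_le' {F : ℤ} (h : F * F ≤ 148) : -12 ≤ F ∧ F ≤ 12 := by
  constructor <;> nlinarith [h]

set_option maxHeartbeats 4000000 in
/-- **the `ℤ/3 × ℤ/3`-folded system has no solution** (`decide +kernel`, `12⁴` cases; `Fᵢ = 2xᵢ − 11`). -/
lemma z3sqFold_core334_system_empty :
    ∀ x1 < 12, ∀ x2 < 12, ∀ x3 < 12, ∀ x4 < 12,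
      ¬ ((-2 * ((2 * ((x1 : ℕ) : ℤ) - 11) + (2 * ((x2 : ℕ) : ℤ) - 11) + (2 * ((x3 : ℕ) : ℤ) - 11) + (2 * ((x4 : ℕ) : ℤ) - 11))) * (-2 * ((2 * ((x1 : ℕ) : ℤ) - 11) + (2 * ((x2 : ℕ) : ℤ) - 11) + (2 * ((x3 : ℕ) : ℤ) - 11) + (2 * ((x4 : ℕ) : ℤ) - 11))) + 2 * ((2 * ((x1 : ℕ) : ℤ) - 11) * (2 * ((x1 : ℕ) : ℤ) - 11) + (2 * ((x2 : ℕ) : ℤ) - 11) * (2 * ((x2 : ℕ) : ℤ) - 11) + (2 * ((x3 : ℕ) : ℤ) - 11) * (2 * ((x3 : ℕ) : ℤ) - 11) + (2 * ((x4 : ℕ) : ℤ) - 11) * (2 * ((x4 : ℕ) : ℤ) - 11)) = 296 ∧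
         2 * (-2 * ((2 * ((x1 : ℕ) : ℤ) - 11) + (2 * ((x2 : ℕ) : ℤ) - 11) + (2 * ((x3 : ℕ) : ℤ) - 11) + (2 * ((x4 : ℕ) : ℤ) - 11))) * (2 * ((x1 : ℕ) : ℤ) - 11) + (2 * ((x1 : ℕ) : ℤ) - 11) * (2 * ((x1 : ℕ) : ℤ) - 11) + 2 * (2 * ((x2 : ℕ) : ℤ) - 11) * (2 * ((x3 : ℕ) : ℤ) - 11) + 2 * (2 * ((x3 : ℕ) : ℤ) - 11) * (2 * ((x4 : ℕ) : ℤ) - 11) + 2 * (2 * ((x2 : ℕ) : ℤ) - 11) * (2 * ((x4 : ℕ) : ℤ) - 11) = -37) := by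
  decide +kernel

/-- **No conference matrix of order `334` has a core developed over `G333 = (ℤ/3 × ℤ/3) × ℤ/37`**: there is no `a : G333 → ℤ` with
`a 0 = 0`, `a g = ±1 (g ≠ 0)` and `PAF_a(g) = −1` for all `g ≠ 0` (no Paley-type partial difference set in `G333`). -/
theorem no_G333Core_conference334 (a : G333 → ℤ) (ha0 : a 0 = 0) (ha : ∀ g, g ≠ 0 → a g = 1 ∨ a g = -1)
    (hpaf : ∀ g : G333, g ≠ 0 → PAFOn a g = -1) : False := by
  have hsym := coreOn_symm_of_paf_neg_one (by rw [card_G333]) a ha0 ha hpaf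
  -- the fold and its symmetry
  have s20 : comp37 a (2, 0) = comp37 a (1, 0) := by
    rw [show ((2, 0) : ZMod 3 × ZMod 3) = -(1, 0) by decide]; exact comp37_symm a hsym _
  have s02 : comp37 a (0, 2) = comp37 a (0, 1) := by
    rw [show ((0, 2) : ZMod 3 × ZMod 3) = -(0, 1) by decide]; exact comp37_symm a hsym _
  have s22 : comp37 a (2, 2) = comp37 a (1, 1) := by
    rw [show ((2, 2) : ZMod 3 × ZMod 3) = -(1, 1) by decide]; exact comp37_symm a hsym _
  have s21 : comp37 a (2, 1) = comp37 a (1, 2) := by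
    rw [show ((2, 1) : ZMod 3 × ZMod 3) = -(1, 2) by decide]; exact comp37_symm a hsym _
  -- square sum, shift (1,0), row sum
  have hsq := comp37_shift_sum a 0
  rw [core334_fold_paf a ha0 ha hpaf 0, if_pos rfl, sum_zmod3sq] at hsq
  simp only [add_zero, s20, s02, s22, s21] at hsq
  have hs1 := comp37_shift_sum a (1, 0)
  rw [core334_fold_paf a ha0 ha hpaf (1, 0), if_neg (by decide), sum_zmod3sq] at hs1
  have h3 : (3 : ZMod 3) = 0 := by decide
  simp only [Prod.mk_add_mk, s20, s02, s22, s21] at hs1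
  norm_num at hs1
  simp only [h3, s20, s02, s22, s21] at hs1
  have hrow := core334_rowsum_G333 a ha0 ha hpaf
  rw [Fintype.sum_prod_type] at hrow
  change ∑ v, comp37 a v = 0 at hrow
  rw [sum_zmod3sq, s20, s02, s22, s21] at hrow
  -- parities
  obtain ⟨k1, hk1⟩ := comp37_core_parity a ha0 ha (1, 0)
  obtain ⟨k2, hk2⟩ := comp37_core_parity a ha0 ha (0, 1)
  obtain ⟨k3, hk3⟩ := comp37_core_parity a ha0 ha (1, 1)
  obtain ⟨k4, hk4⟩ := comp37_core_parity a ha0 ha (1, 2)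
  rw [if_neg (by decide), add_zero] at hk1 hk2 hk3 hk4
  set E0 := comp37 a (0, 0) with hE0
  set F1 := comp37 a (1, 0) with hF1
  set F2 := comp37 a (0, 1) with hF2
  set F3 := comp37 a (1, 1) with hF3
  set F4 := comp37 a (1, 2) with hF4
  have hE0' : E0 = -2 * (F1 + F2 + F3 + F4) := by linarith
  have hsq' : E0 * E0 + 2 * (F1 * F1 + F2 * F2 + F3 * F3 + F4 * F4) = 296 := by linarith only [hsq]
  have hs1' : 2 * E0 * F1 + F1 * F1 + 2 * F2 * F3 + 2 * F3 * F4 + 2 * F2 * F4 = -37 := by linarith only [hs1]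
  have b1 : F1 * F1 ≤ 148 := by
    linarith only [hsq', mul_self_nonneg E0, mul_self_nonneg F2, mul_self_nonneg F3, mul_self_nonneg F4]
  have b2 : F2 * F2 ≤ 148 := by
    linarith only [hsq', mul_self_nonneg E0, mul_self_nonneg F1, mul_self_nonneg F3, mul_self_nonneg F4]
  have b3 : F3 * F3 ≤ 148 := by
    linarith only [hsq', mul_self_nonneg E0, mul_self_nonneg F1, mul_self_nonneg F2, mul_self_nonneg F4]
  have b4 : F4 * F4 ≤ 148 := by
    linarith only [hsq', mul_self_nonneg E0, mul_self_nonneg F1, mul_self_nonneg F2, mul_self_nonneg F3]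
  obtain ⟨a1, a1'⟩ := abs_le_twelve_of_mul_self_le' b1
  obtain ⟨a2, a2'⟩ := abs_le_twelve_of_mul_self_le' b2
  obtain ⟨a3, a3'⟩ := abs_le_twelve_of_mul_self_le' b3
  obtain ⟨a4, a4'⟩ := abs_le_twelve_of_mul_self_le' b4
  obtain ⟨x1, hx1, ex1⟩ : ∃ x : ℕ, x < 12 ∧ F1 = 2 * (x : ℤ) - 11 := ⟨((F1 + 11) / 2).toNat, by omega, by omega⟩
  obtain ⟨x2, hx2, ex2⟩ : ∃ x : ℕ, x < 12 ∧ F2 = 2 * (x : ℤ) - 11 := ⟨((F2 + 11) / 2).toNat, by omega, by omega⟩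
  obtain ⟨x3, hx3, ex3⟩ : ∃ x : ℕ, x < 12 ∧ F3 = 2 * (x : ℤ) - 11 := ⟨((F3 + 11) / 2).toNat, by omega, by omega⟩
  obtain ⟨x4, hx4, ex4⟩ : ∃ x : ℕ, x < 12 ∧ F4 = 2 * (x : ℤ) - 11 := ⟨((F4 + 11) / 2).toNat, by omega, by omega⟩
  refine z3sqFold_core334_system_empty x1 hx1 x2 hx2 x3 hx3 x4 hx4 ⟨?_, ?_⟩
  · rw [← ex1, ← ex2, ← ex3, ← ex4, ← hE0']; exact hsq'
  · rw [← ex1, ← ex2, ← ex3, ← ex4, ← hE0']; exact hs1'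

end Summit.Ventures.DiscreteObjects.Hadamard
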